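/-
b2b-lace packet, CARVER gen 27 (unit `b2b-lace-carver-g27`).  HOME/LEMMAS node D10H-2k-C (child of D10H-2k-T, p215181): the CELL
REDUCTION of the six `f₃` cells at the ALTERNATIVE true SRW tables `srwTrueAlt d α̲ ᾱ` (`NobleF3TrueTablesAlt`) — the twin of tail-g11's
`F3BoundsCellReduction` (T4) with, per natural-row `IM` entry, print's three node inequalities OR the single corrected one.  `d`-generic;
additive; no numeral of any dimension; no named fact; no dimension sentence.
-/
import Literature.Probability.FitznerVanDerHofstad2017.F3BoundsCellReduction
import Literature.Probability.FitznerVanDerHofstad2017.NobleF3TrueTablesAlt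
import HarnessLib

/-!
# Cell reduction of the `f₃` numerator `boundHD75` at the ALTERNATIVE true SRW tables

CITATION HEADER (PLACEMENT v2). Part of a certified REPRODUCTION of R. Fitzner, R. van der Hofstad, *Generalized approach to the
non-backtracking lace expansion*, PTRF **169** (2017) 1041–1119 [NoBLE17], §3.3.5 (3.61)–(3.64) (Step 1 and the table `IM`) and (3.71)–(3.87)
(the bounds `BoundH[i](n,l,x)`, linear in the SRW tables with non-negative coefficients, read as suprema over the cells `S ∈ {𝒳, {0}}`), and
of R. Fitzner, R. van der Hofstad, *Mean-field behavior for nearest-neighbor percolation in `d > 10`*, EJP **22** (2017) no. 43 [FvdH17], §2.5: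

> [NoBLE17] (3.87): "`f₃(z) ≤ max_{{n,l,S} ∈ 𝒮} sup_{x ∈ S} (Σ_{i=1}^5 BoundH[i](n,l,x)) / c_{n,l,S}`" and p. 1079: "the supremum over `S` is
> attained at one of the lowest-order points of `S`, as all involved functions are monotone decreasing in the absolute value of each coordinate".

Every `[cite:]` tag below is a LOCATOR for comparison, not an appeal to authority: all statements are proved here from tree theorems.
DIVERGENCE D80 (packet): see `NobleH1StepD80` / `NobleF3TrueTablesAlt` — the alternative true entry is
`IM_alt[m,l,x] = min (max (𝒥, I/(dα̲), (ᾱ−1)S/(2d²))) (max (𝒥/α̲ + (ᾱ−1) I/(dα̲²)) ((ᾱ−1) S/(2d²α̲²)))` at the true values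
`𝒥 = 𝒥_{m+2,l}(x)`, `I = I_{m+3,l}(x)`, `S = S_{m+3,l}(x)`.

## What is here (all proved, `d`-generic)

§1 `F3Bounds.CellDomAlt d α̲ ᾱ m l t` — the per-entry CELL DOMINATION under the alternative: a cell sup `Jc` of `𝒥_{m+2,l}` over `𝒳` with EITHER
   print's triple `Jc ≤ t`, `srwINode2 d (m+3) l ≤ dα̲·t`, `(ᾱ−1)·srwIShift2Node2 d (m+3) l ≤ 2d²·t` OR the single corrected inequality
   `env d Jc (srwINode2 d (m+3) l) (srwIShift2Node2 d (m+3) l) α̲ ᾱ 1 2 ≤ t`; constructors `cellDomAlt_of_printed`, `cellDomAlt_of_env_le`; and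
   `srwTrueAlt_IM_natCast_le_of_cellDomAlt`: it bounds `IM_alt[m,l,x] ≤ t` for every `x ∈ 𝒳` (node reduction of `I`, `S` by
   `SrwIntegralIShiftCellSup` via `F3BoundsCellReduction` §3, monotonicity of `env` by `NobleF3TrueTablesAlt` §1).
§2 THE CELL THEOREMS at `srwTrueAlt d α̲ ᾱ`, `1 ≤ ᾱ`, `0 < α̲`, `d ≥ 9`: **`boundHD75_srwTrueAlt_zero_cell_le`** (cell `(0,l)` over `𝒳`),
   **`boundHD75_srwTrueAlt_one_cell_le`** (cells `(1,l)` over `𝒳`) — hypotheses = one `CellDomAlt` per read natural-row `IM` entry, print's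
   `m = −1` node pair, the cell sups over `𝒳` of `srwTS d α̲`, `srwU d`, `srwK d` at the read entries, and the constant inequality
   `boundHD75 (Tables.cell IMc Tc Uc Kc) n l 0 a ≤ b` — exactly tail-g11's §4 with the per-entry triple replaced by `CellDomAlt`.
§3 **`boundHD75_srwTrueAlt_one_zero_le`**: the `x = 0` cell `(1,l)` from the entry values AT THE ORIGIN, per natural row EITHER print's origin
   triple OR `env d (𝒥(0)) (I(0)) (2d·I(2e₁)) α̲ ᾱ 1 2 ≤ IMc` (`S_{p,l'}(0) = 2d I_{p,l'}(2e₁)`) — `F3Bounds.OriginDomAlt`.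

## What is NOT here
No dimension, no table, no numeric value, no certificate.  Heartbeat census (packet filing rule): every declaration is a short order-algebra
step or a term-mode composition; nothing approaches 100 000; no option set.
-/

noncomputable section

namespace Literature.Probability.FitznerVanDerHofstad2017

open Finset Real
open Literature.Barriers.CriticalPhenomena Literature.Probability.LatticeModels

namespace F3Bounds

variable {d : ℕ} {afmin afmax : ℝ}

/-! ### §1  Per-entry cell domination under the alternative -/

/-- **Per-entry cell domination under the alternative** for the natural row `m`, column `l` and a literal `t`: a cell sup `Jc` of `𝒥_{m+2,l}`
over `𝒳` such that EITHER print's triple (`Jc ≤ t`, `max_{nodes} I_{m+3,l} ≤ dα̲·t`, `(ᾱ−1)·(node bound of S_{m+3,l}) ≤ 2d²·t`) OR the corrected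
inequality `env d Jc (srwINode2 d (m+3) l) (srwIShift2Node2 d (m+3) l) α̲ ᾱ 1 2 ≤ t` holds.
[cite: FitznerVanDerHofstad2016NoBLE, §3.3.5 (3.61)–(3.64) pp. 1074–1076; p. 1079; Lemma 5.1 p. 1093] -/
def CellDomAlt (d : ℕ) (afmin afmax : ℝ) (m l : ℕ) (t : ℝ) : Prop :=
  ∃ Jc : ℝ, (∀ x ∈ calX d, srwJ d (m + 2) l x ≤ Jc) ∧
    ((Jc ≤ t ∧ srwINode2 d (m + 3) l ≤ d * afmin * t ∧ (afmax - 1) * srwIShift2Node2 d (m + 3) l ≤ 2 * (d : ℝ) ^ 2 * t) ∨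
      H1SlotD80.env d Jc (srwINode2 d (m + 3) l) (srwIShift2Node2 d (m + 3) l) afmin afmax 1 2 ≤ t)

/-- Print's branch of `CellDomAlt` (tail-g11's three hypotheses per entry). [cite: FitznerVanDerHofstad2016NoBLE, §3.3.5 (3.64) p. 1076; p. 1079] -/
theorem cellDomAlt_of_printed {m l : ℕ} {t : ℝ} (hJ : ∀ x ∈ calX d, srwJ d (m + 2) l x ≤ t)
    (hI : srwINode2 d (m + 3) l ≤ d * afmin * t) (hS : (afmax - 1) * srwIShift2Node2 d (m + 3) l ≤ 2 * (d : ℝ) ^ 2 * t) :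
    CellDomAlt d afmin afmax m l t :=
  ⟨t, hJ, Or.inl ⟨le_rfl, hI, hS⟩⟩

/-- The corrected branch of `CellDomAlt`: a cell sup `Jc` of `𝒥_{m+2,l}` and ONE inequality on the corrected majorant at the node values.
[cite: FitznerVanDerHofstad2016NoBLE, §3.3.5 (3.61)–(3.62), (3.64) p. 1076; p. 1079] -/
theorem cellDomAlt_of_env_le {m l : ℕ} {t Jc : ℝ} (hJ : ∀ x ∈ calX d, srwJ d (m + 2) l x ≤ Jc)
    (h : H1SlotD80.env d Jc (srwINode2 d (m + 3) l) (srwIShift2Node2 d (m + 3) l) afmin afmax 1 2 ≤ t) :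
    CellDomAlt d afmin afmax m l t :=
  ⟨Jc, hJ, Or.inr h⟩

/-- **One natural-row entry of the ALTERNATIVE true tables on `𝒳` from `CellDomAlt`** (`0 < α̲`, `1 ≤ ᾱ`, `d ≥ 2m+7`).
[cite: FitznerVanDerHofstad2016NoBLE, §3.3.5 (3.61)–(3.64) pp. 1074–1076, (3.30) p. 1070, p. 1079; Lemma 5.1 p. 1093] -/
theorem srwTrueAlt_IM_natCast_le_of_cellDomAlt (hα : 0 < afmin) (hᾱ : 1 ≤ afmax) {m l : ℕ} (hd : 2 * (m + 3) + 1 ≤ d) {t : ℝ}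
    (h : CellDomAlt d afmin afmax m l t) {x : Fin d → ℤ} (hx : x ∈ calX d) : (srwTrueAlt d afmin afmax).IM m l x ≤ t := by
  obtain ⟨Jc, hJ, h | h⟩ := h
  · obtain ⟨hJt, hI, hS⟩ := h
    exact srwTrueAlt_IM_natCast_le_of_printed (by omega) hα ((hJ x hx).trans hJt)
      ((srwI_le_srwINode2_of_mem_calX (by omega) hd l hx).trans hI)
      ((mul_le_mul_of_nonneg_left (srwIShift2_le_srwIShift2Node2_of_mem_calX (by omega) hd l hx) (by linarith)).trans hS)
  · have hdpos : (0 : ℝ) < d := Nat.cast_pos.mpr (by omega)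
    refine srwTrueAlt_IM_natCast_le_of_env_le (le_trans ?_ h)
    exact H1SlotD80.env_mono 1 2 hdpos hα hᾱ (hJ x hx) (srwI_le_srwINode2_of_mem_calX (by omega) hd l hx)
      (srwIShift2_le_srwIShift2Node2_of_mem_calX (by omega) hd l hx)

/-! ### §2  The cells at the alternative true tables -/

/-- **The cell `(0,l)` over `𝒳` at the ALTERNATIVE true tables.**  From: one `CellDomAlt` per read natural-row entry `IM (0,l)`, `IM (0,l+1)`; print's
node pair for the `m = −1` row (`I_{1,l+1} + S_{2,l}/(2d²α̲)`, `I_{2,l}`); the cell sups over `𝒳` of `T^{(5.11)}_{2,l}, T^{(5.11)}_{2,l+1}, T^{(5.11)}_{1,l}`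
(`srwTS d α̲`), `U_{2,l}, U_{3,l}`, `K_{1,l}, K_{2,l}`; and `boundHD75 (Tables.cell IMc Tc Uc Kc) 0 l 0 a ≤ b` — conclude
`boundHD75 (srwTrueAlt d α̲ ᾱ) 0 l x a ≤ b` for every `x ∈ 𝒳`.
[cite: FitznerVanDerHofstad2016NoBLE, §3.3.5 (3.87) p. 1079; (3.71)–(3.86)] [cite: FitznerVanDerHofstad2017, §2.5; notebook General.nb In[2]–In[3]] -/
theorem boundHD75_srwTrueAlt_zero_cell_le (hd : 9 ≤ d) (hα : 0 < afmin) (hᾱ : 1 ≤ afmax) {a : Args} (ha : a.WF)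
    {IMc : ℤ → ℕ → ℝ} {Tc Uc Kc : ℕ → ℕ → ℝ} {l : ℕ} {b : ℝ}
    (hE0 : CellDomAlt d afmin afmax 0 l (IMc 0 l)) (hE0' : CellDomAlt d afmin afmax 0 (l + 1) (IMc 0 (l + 1)))
    (hN1 : srwINode2 d 1 (l + 1) + srwIShift2Node2 d 2 l / (2 * (d : ℝ) ^ 2 * afmin) ≤ IMc (-1) l)
    (hN2 : srwINode2 d 2 l ≤ d * afmin * IMc (-1) l)
    (hT2 : ∀ x ∈ calX d, srwTS d afmin 2 l x ≤ Tc 2 l) (hT2' : ∀ x ∈ calX d, srwTS d afmin 2 (l + 1) x ≤ Tc 2 (l + 1))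
    (hT1 : ∀ x ∈ calX d, srwTS d afmin 1 l x ≤ Tc 1 l)
    (hU2 : ∀ x ∈ calX d, srwU d 2 l x ≤ Uc 2 l) (hU3 : ∀ x ∈ calX d, srwU d 3 l x ≤ Uc 3 l)
    (hK1 : ∀ x ∈ calX d, srwK d 1 l x ≤ Kc 1 l) (hK2 : ∀ x ∈ calX d, srwK d 2 l x ≤ Kc 2 l)
    (hnum : boundHD75 (Tables.cell IMc Tc Uc Kc : Tables (Fin d → ℤ)) 0 l 0 a ≤ b) :
    ∀ x ∈ calX d, boundHD75 (srwTrueAlt d afmin afmax) 0 l x a ≤ b := by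
  intro x hx
  refine le_trans ?_ ((boundHD75_cell_irrel IMc Tc Uc Kc 0 l x 0 a).le.trans hnum)
  have hneg : (srwTrueAlt d afmin afmax).IM (-1) l x ≤ IMc (-1) l := by
    rw [srwTrueAlt_IM_negOne]; exact srwTrue_IM_negOne_le_of_cell hα (by omega) hN1 hN2 hx
  exact boundHD75_zero_le_of_entries ha
    (srwTrueAlt_IM_natCast_le_of_cellDomAlt hα hᾱ (by omega) hE0 hx)
    (srwTrueAlt_IM_natCast_le_of_cellDomAlt hα hᾱ (by omega) hE0' hx)
    hneg (hT2 x hx) (hT2' x hx) (hT1 x hx) (hU2 x hx) (hU3 x hx) (hK1 x hx) (hK2 x hx)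

/-- **The cells `(1,l)` over `𝒳` at the ALTERNATIVE true tables.**  From: one `CellDomAlt` per read natural-row entry `IM (1,l)`, `(0,l)`, `(1,l+1)`,
`(0,l+1)`, `(1,l+2)`; the cell sups over `𝒳` of `T^{(5.11)}_{3,l}, T^{(5.11)}_{3,l+1}, T^{(5.11)}_{2,l}`, `U_{3,l}, U_{4,l}`, `K_{2,l}, K_{3,l}`; and
`boundHD75 (Tables.cell IMc Tc Uc Kc) 1 l 0 a ≤ b` — conclude `boundHD75 (srwTrueAlt d α̲ ᾱ) 1 l x a ≤ b` for every `x ∈ 𝒳`.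
[cite: FitznerVanDerHofstad2016NoBLE, §3.3.5 (3.87) p. 1079; (3.71)–(3.86)] [cite: FitznerVanDerHofstad2017, §2.5; notebook General.nb In[2]–In[3]] -/
theorem boundHD75_srwTrueAlt_one_cell_le (hd : 9 ≤ d) (hα : 0 < afmin) (hᾱ : 1 ≤ afmax) {a : Args} (ha : a.WF)
    {IMc : ℤ → ℕ → ℝ} {Tc Uc Kc : ℕ → ℕ → ℝ} {l : ℕ} {b : ℝ}
    (hE1 : CellDomAlt d afmin afmax 1 l (IMc 1 l)) (hE0 : CellDomAlt d afmin afmax 0 l (IMc 0 l))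
    (hE1' : CellDomAlt d afmin afmax 1 (l + 1) (IMc 1 (l + 1))) (hE0' : CellDomAlt d afmin afmax 0 (l + 1) (IMc 0 (l + 1)))
    (hE1'' : CellDomAlt d afmin afmax 1 (l + 2) (IMc 1 (l + 2)))
    (hT3 : ∀ x ∈ calX d, srwTS d afmin 3 l x ≤ Tc 3 l) (hT3' : ∀ x ∈ calX d, srwTS d afmin 3 (l + 1) x ≤ Tc 3 (l + 1))
    (hT2 : ∀ x ∈ calX d, srwTS d afmin 2 l x ≤ Tc 2 l)
    (hU3 : ∀ x ∈ calX d, srwU d 3 l x ≤ Uc 3 l) (hU4 : ∀ x ∈ calX d, srwU d 4 l x ≤ Uc 4 l)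
    (hK2 : ∀ x ∈ calX d, srwK d 2 l x ≤ Kc 2 l) (hK3 : ∀ x ∈ calX d, srwK d 3 l x ≤ Kc 3 l)
    (hnum : boundHD75 (Tables.cell IMc Tc Uc Kc : Tables (Fin d → ℤ)) 1 l 0 a ≤ b) :
    ∀ x ∈ calX d, boundHD75 (srwTrueAlt d afmin afmax) 1 l x a ≤ b := by
  intro x hx
  refine le_trans ?_ ((boundHD75_cell_irrel IMc Tc Uc Kc 1 l x 0 a).le.trans hnum)
  exact boundHD75_one_le_of_entries ha
    (srwTrueAlt_IM_natCast_le_of_cellDomAlt hα hᾱ (by omega) hE1 hx)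
    (srwTrueAlt_IM_natCast_le_of_cellDomAlt hα hᾱ (by omega) hE0 hx)
    (srwTrueAlt_IM_natCast_le_of_cellDomAlt hα hᾱ (by omega) hE1' hx)
    (srwTrueAlt_IM_natCast_le_of_cellDomAlt hα hᾱ (by omega) hE0' hx)
    (srwTrueAlt_IM_natCast_le_of_cellDomAlt hα hᾱ (by omega) hE1'' hx)
    (hT3 x hx) (hT3' x hx) (hT2 x hx) (hU3 x hx) (hU4 x hx) (hK2 x hx) (hK3 x hx)

/-! ### §3  The `x = 0` cell -/

/-- **Per-entry ORIGIN domination under the alternative** for the natural row `m`, column `l` and a literal `t`: EITHER print's origin triple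
`𝒥_{m+2,l}(0) ≤ t`, `I_{m+3,l}(0) ≤ dα̲·t`, `(ᾱ−1)·2d·I_{m+3,l}(2e₁) ≤ 2d²·t` OR `env d (𝒥_{m+2,l}(0)) (I_{m+3,l}(0)) (2d·I_{m+3,l}(2e₁)) α̲ ᾱ 1 2 ≤ t`
(`S_{p,l}(0) = 2d·I_{p,l}(2e₁)`). [cite: FitznerVanDerHofstad2016NoBLE, §3.3.5 (3.61)–(3.64) pp. 1074–1076; (3.30) p. 1070] -/
def OriginDomAlt (d : ℕ) (afmin afmax : ℝ) (m l : ℕ) (t : ℝ) : Prop :=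
  (srwJ d (m + 2) l 0 ≤ t ∧ srwI d (m + 3) l 0 ≤ d * afmin * t ∧
      (afmax - 1) * (2 * d * srwI d (m + 3) l (vecOfParts d [2])) ≤ 2 * (d : ℝ) ^ 2 * t) ∨
    H1SlotD80.env d (srwJ d (m + 2) l 0) (srwI d (m + 3) l 0) (2 * d * srwI d (m + 3) l (vecOfParts d [2])) afmin afmax 1 2 ≤ t

/-- One natural-row entry of the ALTERNATIVE true tables AT THE ORIGIN from `OriginDomAlt` (`d ≥ 1`, `0 < α̲`).
[cite: FitznerVanDerHofstad2016NoBLE, §3.3.5 (3.61)–(3.64) pp. 1074–1076; (3.30) p. 1070] -/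
theorem srwTrueAlt_IM_natCast_zero_le_of_originDomAlt (hd : 1 ≤ d) (hα : 0 < afmin) {m l : ℕ} {t : ℝ}
    (h : OriginDomAlt d afmin afmax m l t) : (srwTrueAlt d afmin afmax).IM m l 0 ≤ t := by
  rcases h with ⟨hJ, hI, hS⟩ | h
  · exact srwTrueAlt_IM_natCast_le_of_printed hd hα hJ hI (by rwa [srwIShift2_zero _ _ hd])
  · refine srwTrueAlt_IM_natCast_le_of_env_le ?_
    unfold srwEnvIM
    rwa [srwIShift2_zero _ _ hd]

/-- **The `x = 0` cell `(1,l)` at the ALTERNATIVE true tables** from the entry values AT THE ORIGIN (no sup step): one `OriginDomAlt` per read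
natural-row entry, the origin values of `T^{(5.11)}`, `U`, `K`, and `boundHD75 (Tables.cell IMc Tc Uc Kc) 1 l 0 a ≤ b`.
[cite: FitznerVanDerHofstad2016NoBLE, §3.3.5 (3.87) p. 1079 (cell `{0}`); (3.30), (3.35)] [cite: FitznerVanDerHofstad2017, §2.5] -/
theorem boundHD75_srwTrueAlt_one_zero_le (hd : 1 ≤ d) (hα : 0 < afmin) {a : Args} (ha : a.WF)
    {IMc : ℤ → ℕ → ℝ} {Tc Uc Kc : ℕ → ℕ → ℝ} {l : ℕ} {b : ℝ}
    (hE1 : OriginDomAlt d afmin afmax 1 l (IMc 1 l)) (hE0 : OriginDomAlt d afmin afmax 0 l (IMc 0 l))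
    (hE1' : OriginDomAlt d afmin afmax 1 (l + 1) (IMc 1 (l + 1))) (hE0' : OriginDomAlt d afmin afmax 0 (l + 1) (IMc 0 (l + 1)))
    (hE1'' : OriginDomAlt d afmin afmax 1 (l + 2) (IMc 1 (l + 2)))
    (hT3 : srwTS d afmin 3 l 0 ≤ Tc 3 l) (hT3' : srwTS d afmin 3 (l + 1) 0 ≤ Tc 3 (l + 1)) (hT2 : srwTS d afmin 2 l 0 ≤ Tc 2 l)
    (hU3 : srwU d 3 l 0 ≤ Uc 3 l) (hU4 : srwU d 4 l 0 ≤ Uc 4 l) (hK2 : srwK d 2 l 0 ≤ Kc 2 l) (hK3 : srwK d 3 l 0 ≤ Kc 3 l)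
    (hnum : boundHD75 (Tables.cell IMc Tc Uc Kc : Tables (Fin d → ℤ)) 1 l 0 a ≤ b) :
    boundHD75 (srwTrueAlt d afmin afmax) 1 l 0 a ≤ b := by
  refine le_trans ?_ hnum
  exact boundHD75_one_le_of_entries ha (srwTrueAlt_IM_natCast_zero_le_of_originDomAlt hd hα hE1)
    (srwTrueAlt_IM_natCast_zero_le_of_originDomAlt hd hα hE0) (srwTrueAlt_IM_natCast_zero_le_of_originDomAlt hd hα hE1')
    (srwTrueAlt_IM_natCast_zero_le_of_originDomAlt hd hα hE0') (srwTrueAlt_IM_natCast_zero_le_of_originDomAlt hd hα hE1'')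
    hT3 hT3' hT2 hU3 hU4 hK2 hK3

/-- Print's branch of `OriginDomAlt`. [cite: FitznerVanDerHofstad2016NoBLE, §3.3.5 (3.64) p. 1076; (3.30) p. 1070] -/
theorem originDomAlt_of_printed {m l : ℕ} {t : ℝ} (hJ : srwJ d (m + 2) l 0 ≤ t) (hI : srwI d (m + 3) l 0 ≤ d * afmin * t)
    (hS : (afmax - 1) * (2 * d * srwI d (m + 3) l (vecOfParts d [2])) ≤ 2 * (d : ℝ) ^ 2 * t) :
    OriginDomAlt d afmin afmax m l t :=
  Or.inl ⟨hJ, hI, hS⟩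

/-- The corrected branch of `OriginDomAlt`, from MAJORANTS of the three origin quantities (`d > 0`, `α̲ > 0`, `ᾱ ≥ 1`).
[cite: FitznerVanDerHofstad2016NoBLE, §3.3.5 (3.61)–(3.62), (3.64) p. 1076; (3.30) p. 1070] -/
theorem originDomAlt_of_env_majorants_le (hd : 1 ≤ d) (hα : 0 < afmin) (hᾱ : 1 ≤ afmax) {m l : ℕ} {t J' I' I2' : ℝ}
    (hJ : srwJ d (m + 2) l 0 ≤ J') (hI : srwI d (m + 3) l 0 ≤ I') (hI2 : srwI d (m + 3) l (vecOfParts d [2]) ≤ I2')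
    (h : H1SlotD80.env d J' I' (2 * d * I2') afmin afmax 1 2 ≤ t) : OriginDomAlt d afmin afmax m l t := by
  have hdpos : (0 : ℝ) < d := Nat.cast_pos.mpr (by omega)
  refine Or.inr (le_trans (H1SlotD80.env_mono 1 2 hdpos hα hᾱ hJ hI ?_) h)
  exact mul_le_mul_of_nonneg_left hI2 (by positivity)

end F3Bounds

end Literature.Probability.FitznerVanDerHofstad2017

end
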